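import Literature.AlgebraicGeometry.Deformation.TrivialDeformationIdealSheaf
import Literature.AlgebraicGeometry.HodgeTheory.AtiyahClass
import HarnessLib

/-!
# The first-order flow of a global vector field: `Φ_D : X × Spec k[ε] → X`, `Φ♯ f = f + ε · D(df)`
# (Mumford, *Abelian Varieties* §13, proof of the Theorem; Hartshorne, *Deformation Theory* Ex. 5.2 globalised)

Layer `Literature/AlgebraicGeometry/Deformation`, namespace `Literature.AlgebraicGeometry.Deformation`.  THEOREMS ONLY
(no definition, no instance, no notation, no named fact, no `sorry`).

For a scheme `X` over a field `k` and a GLOBAL VECTOR FIELD, i.e. an `𝒪_X`-linear map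
`D : Ω¹_{X/k}|_⊤ ⟶ 𝒪_X|_⊤` (the dialect of ★ `Deformation/ContractedDlogCocycleSpan`, ★ `HodgeTheory/AtiyahClass`:
`D(df) = appLE D (homOfLE le_top) (dSection X U f)`), the INFINITESIMAL AUTOMORPHISM `f + εg ↦ f + ε(D(df) + g)` of the
trivial first-order deformation `X' = X × Spec k[ε]` ([Hartshorne2010] Ex. 5.2: «the automorphisms of `B'` are given by
`T⁰(B/k, B)`», ★ `Deformation/DualNumberDerivationAutomorphisms` on one affine chart) composed with the projection is a
morphism `Φ_D : X' → X` OVER `Spec k` — the FIRST-ORDER FLOW of `D` ([MumfordAV1970] §13 p. 125: the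
`k[ε]`-valued point `t_{εD}` through which the tangent map of `x ↦ t_x^*L ⊗ L⁻¹` is computed; [GortzWedhorn2023]
Rem. 27.18 (4): `U[ε]`-valued points).  It is constructed DIRECTLY as a morphism of locally ringed spaces with the
underlying continuous map of the projection `p : X' → X` (so that `Φ⁻¹ U = p⁻¹ U` on the nose) and the sheaf map
`f ↦ p♯ f + t · p♯(D(df))`, `t ∈ Γ(X', 𝒪)` the deformation parameter (★ `TrivialDeformationIdealSheaf.deformationParam`,
`t² = 0`): a ring map by Leibniz and `t² = 0`, natural in `U`, local on stalks (it is `p♯` up to a nilpotent), and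
`k`-linear because `d` kills `k`.

* §1 `add_mul_add_eq_of_mul_self_eq_zero`, `isUnit_of_isUnit_add_mul_of_mul_self_eq_zero` — arithmetic modulo `t² = 0`;
* §2 the vector-field calculus `D(d(fg)) = f D(dg) + g D(df)`, `D(d1) = 0`, `D(d(f|)) = D(df)|`, `D(dc) = 0` for `c ∈ k`;
* §3 for ANY morphism `p : X' → X` and ANY global `t` on `X'` with `t² = 0`, the maps `f ↦ p♯ f + t|·p♯(D(df))` are ring
  homomorphisms `Γ(X, U) → Γ(X', p⁻¹U)` natural in `U` (`flowApp_mul`, `flowApp_map`, …);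
* §4 **`exists_firstOrderFlow`** — the flow `Φ : X ⊗ Spec k[ε] ⟶ X` in `Over (Spec k)`: the identity on the closed fibre
  (`closedFibreι ≫ Φ = 𝟙`), underlying map `p`, and the SECTION FORMULA
  `Φ.appLE U V _ f = p.appLE U V _ f + t|_V · p.appLE U V _ (D(df))` on every `V ≤ p⁻¹ U` — the letter (α) of the cell's
  `SOCKETS-I2a-seam.v0` (F-11 (I2-a), «`φ_L` injective»), consumed by `AbelianSchemes/VectorFieldFlowIsTranslation` and
  ★ `AbelianSchemes/FirstOrderTranslateClassOfDlogCoboundary`.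

Cell hodgecm-mathlib (D-0151), F0P1b WAVE 4 (W4-2) (I2-a) road step (α) (B-p08 (g16)); count-neutral generic capital.
HC_CM is proved only modulo the 7 printed citations until rung 0 closes; this file asserts nothing about HC.

## References
* [MumfordAV1970] D. Mumford, *Abelian Varieties* (1970), §13, proof of the Theorem (p. 125).
* [Hartshorne2010] R. Hartshorne, *Deformation Theory* (2010), Ex. 5.2 (p. 45) and §2 proof of Prop. 2.6 (p. 13).
* [GortzWedhorn2023] U. Görtz, T. Wedhorn, *Algebraic Geometry II* (2023), Rem. 27.18 (4), Prop. 27.122.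
* [Hartshorne1977] R. Hartshorne, *Algebraic Geometry* (1977), II.8 (pp. 172–175), II Ex. 2.4.
-/

noncomputable section

-- `TopCat.Presheaf`/`Scheme.Modules` are not reducible (as in ★ `Deformation/TrivialDeformationIdealSheaf`).
set_option backward.isDefEq.respectTransparency false

universe u

open CategoryTheory CategoryTheory.Limits AlgebraicGeometry Opposite TopologicalSpace MonoidalCategory
  CartesianMonoidalCategory

namespace Literature.AlgebraicGeometry.Deformation

open Literature.AlgebraicGeometry.Modules Literature.AlgebraicGeometry.Motives Literature.AlgebraicGeometry.HodgeTheory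

/-! ## §1 Arithmetic modulo `t² = 0` -/

/-- `(a + t a′)(b + t b′) = ab + t(ab′ + ba′)` when `t² = 0` (the multiplication of `B[ε] = B ⊕ εB`).
[cite: Hartshorne2010, §2 (p. 10)] -/
theorem add_mul_add_eq_of_mul_self_eq_zero {R : Type*} [CommRing R] {t : R} (ht : t * t = 0) (a a' b b' : R) :
    (a + t * a') * (b + t * b') = a * b + t * (a * b' + b * a') := by
  linear_combination (a' * b') * ht

/-- If `a + t·b` is a unit and `t² = 0` then `a` is a unit (`a = (a + tb)(1 − (a + tb)⁻¹ t b)`, one minus a nilpotent).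
[cite: Hartshorne2010, §2 proof of Prop. 2.6 (p. 13: «𝒪_{X'}^* → 𝒪_X^*»)] -/
theorem isUnit_of_isUnit_add_mul_of_mul_self_eq_zero {R : Type*} [CommRing R] {t : R} (ht : t * t = 0) {a b : R}
    (h : IsUnit (a + t * b)) : IsUnit a := by
  obtain ⟨u, hu⟩ := h
  have hn : IsNilpotent (↑u⁻¹ * (t * b)) := ⟨2, by rw [pow_two]; linear_combination (↑u⁻¹ * ↑u⁻¹ * b * b) * ht⟩
  have h1 : IsUnit (1 - ↑u⁻¹ * (t * b)) := hn.isUnit_one_sub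
  have ha : a = ↑u * (1 - ↑u⁻¹ * (t * b)) := by
    rw [mul_sub, mul_one, ← mul_assoc, Units.mul_inv, one_mul]
    linear_combination -hu
  rw [ha]
  exact (Units.isUnit u).mul h1

/-! ## §2 The calculus of a global vector field `D : Ω¹_{X/k}|_⊤ → 𝒪_X|_⊤` -/

section VectorField

variable {k : Type u} [Field k] {X : Over (Spec (CommRingCat.of k))}
  (D : (cotangentSheaf X).over ⊤ ⟶ (unitModule X.left).over ⊤)

/-- `D(d(f + g)) = D(df) + D(dg)`. [cite: Hartshorne1977, II.8 (p. 172)] -/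
theorem appLE_dSection_add (U : X.left.Opens) (f g : Γ(X.left, U)) :
    (show Γ(X.left, U) from appLE D (homOfLE le_top) (dSection X U (f + g))) =
      (show Γ(X.left, U) from appLE D (homOfLE le_top) (dSection X U f)) +
        show Γ(X.left, U) from appLE D (homOfLE le_top) (dSection X U g) := by
  rw [dSection_add, appLE_add_right]

/-- **Leibniz**: `D(d(fg)) = f·D(dg) + g·D(df)`. [cite: Hartshorne1977, II.8 (p. 172)] -/
theorem appLE_dSection_mul (U : X.left.Opens) (f g : Γ(X.left, U)) :
    (show Γ(X.left, U) from appLE D (homOfLE le_top) (dSection X U (f * g))) =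
      f * (show Γ(X.left, U) from appLE D (homOfLE le_top) (dSection X U g)) +
        g * show Γ(X.left, U) from appLE D (homOfLE le_top) (dSection X U f) := by
  rw [dSection_mul, appLE_add_right]
  change (show Γ(X.left, U) from appLE D (homOfLE le_top) (f • dSection X U g)) +
      (show Γ(X.left, U) from appLE D (homOfLE le_top) (g • dSection X U f)) = _
  rw [appLE_smul_right, appLE_smul_right]
  rfl

/-- `D(d1) = 0`. [cite: Hartshorne1977, II.8 (p. 172)] -/
theorem appLE_dSection_one (U : X.left.Opens) :
    (show Γ(X.left, U) from appLE D (homOfLE le_top) (dSection X U 1)) = 0 := by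
  rw [dSection_one, appLE_zero_right]

/-- `D(d0) = 0`. [cite: Hartshorne1977, II.8 (p. 172)] -/
theorem appLE_dSection_zero (U : X.left.Opens) :
    (show Γ(X.left, U) from appLE D (homOfLE le_top) (dSection X U 0)) = 0 := by
  rw [dSection_zero, appLE_zero_right]

/-- `D(df)|_V = D(d(f|_V))` (`d` and `D` commute with restriction). [cite: Hartshorne1977, II.8 Prop. 8.2A and p. 175] -/
theorem map_appLE_dSection {U V : X.left.Opens} (i : V ⟶ U) (f : Γ(X.left, U)) :
    X.left.presheaf.map i.op (show Γ(X.left, U) from appLE D (homOfLE le_top) (dSection X U f)) =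
      show Γ(X.left, V) from appLE D (homOfLE le_top) (dSection X V (X.left.presheaf.map i.op f)) := by
  have hi : (homOfLE (le_top : V ≤ ⊤)) = i ≫ homOfLE (le_top : U ≤ ⊤) := Subsingleton.elim _ _
  change _ = appLE D (homOfLE (le_top : V ≤ ⊤)) _
  rw [← map_dSection, hi, appLE_map]
  rfl

/-- **`d` kills the constants**: `D(dc) = 0` for `c` in the image of `k → Γ(X, U)` (the structure presheaf map
★ `Motives.constToPresheaf`). [cite: Hartshorne1977, II.8 (p. 172: «d is A-linear»)] -/
theorem appLE_dSection_constToPresheaf (U : X.left.Opens) (c : k) :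
    (show Γ(X.left, U) from appLE D (homOfLE le_top) (dSection X U ((constToPresheaf X).app (op U) c))) = 0 := by
  have h : dSection X U ((constToPresheaf X).app (op U) c) = 0 := (dCotangent X).d_app (X := op U) c
  rw [h, appLE_zero_right]

/-- `D(d(c|_U)) = 0` for a global section `c = π♯ c₀` pulled back from `Spec k` along the structure morphism.
[cite: Hartshorne1977, II.8 (p. 172: «d is A-linear»)] -/
theorem appLE_dSection_map_appTop (U : X.left.Opens) (c₀ : Γ(Spec (CommRingCat.of k), ⊤)) :
    (show Γ(X.left, U) from appLE D (homOfLE le_top)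
      (dSection X U (X.left.presheaf.map (homOfLE (le_top : U ≤ ⊤)).op (X.hom.appTop c₀)))) = 0 := by
  have h := appLE_dSection_constToPresheaf D U ((Scheme.ΓSpecIso (CommRingCat.of k)).hom c₀)
  have hc : (constToPresheaf X).app (op U) ((Scheme.ΓSpecIso (CommRingCat.of k)).hom c₀) =
      X.left.presheaf.map (homOfLE (le_top : U ≤ ⊤)).op (X.hom.appTop c₀) := by
    change ((Scheme.ΓSpecIso (CommRingCat.of k)).inv ≫ X.hom.appTop ≫ X.left.presheaf.map (homOfLE le_top).op)
        ((Scheme.ΓSpecIso (CommRingCat.of k)).hom c₀) = _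
    rw [← CategoryTheory.comp_apply, Iso.hom_inv_id_assoc]
    rfl
  rwa [hc] at h

end VectorField

/-! ## §3 The flow maps `f ↦ p♯ f + t · p♯(D(df))` are ring homomorphisms, natural in the open -/

section FlowApp

variable {k : Type u} [Field k] {X : Over (Spec (CommRingCat.of k))}
  (D : (cotangentSheaf X).over ⊤ ⟶ (unitModule X.left).over ⊤) {X' : Scheme.{u}} (p : X' ⟶ X.left) (t : Γ(X', ⊤))

/-- `1 ↦ 1`. [cite: Hartshorne2010, Ex. 5.2 (p. 45)] -/
theorem flowApp_one (U : X.left.Opens) :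
    p.app U 1 + sectionOn t (p ⁻¹ᵁ U) *
        p.app U (show Γ(X.left, U) from appLE D (homOfLE le_top) (dSection X U 1)) = 1 := by
  rw [appLE_dSection_one, map_one, map_zero, mul_zero, add_zero]

/-- `0 ↦ 0`. [cite: Hartshorne2010, Ex. 5.2 (p. 45)] -/
theorem flowApp_zero (U : X.left.Opens) :
    p.app U 0 + sectionOn t (p ⁻¹ᵁ U) *
        p.app U (show Γ(X.left, U) from appLE D (homOfLE le_top) (dSection X U 0)) = 0 := by
  rw [appLE_dSection_zero, map_zero, mul_zero, add_zero]

/-- Additivity. [cite: Hartshorne2010, Ex. 5.2 (p. 45)] -/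
theorem flowApp_add (U : X.left.Opens) (f g : Γ(X.left, U)) :
    p.app U (f + g) + sectionOn t (p ⁻¹ᵁ U) *
        p.app U (show Γ(X.left, U) from appLE D (homOfLE le_top) (dSection X U (f + g))) =
      (p.app U f + sectionOn t (p ⁻¹ᵁ U) *
          p.app U (show Γ(X.left, U) from appLE D (homOfLE le_top) (dSection X U f))) +
        (p.app U g + sectionOn t (p ⁻¹ᵁ U) *
          p.app U (show Γ(X.left, U) from appLE D (homOfLE le_top) (dSection X U g))) := by
  rw [appLE_dSection_add, map_add, map_add]
  ring

/-- **Multiplicativity** (Leibniz and `t² = 0`): `x + ty ↦ x + t(y + Dx)` is a ring map of `B[t]/t²`.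
[cite: Hartshorne2010, Ex. 5.2 (p. 45)] -/
theorem flowApp_mul (ht : t * t = 0) (U : X.left.Opens) (f g : Γ(X.left, U)) :
    p.app U (f * g) + sectionOn t (p ⁻¹ᵁ U) *
        p.app U (show Γ(X.left, U) from appLE D (homOfLE le_top) (dSection X U (f * g))) =
      (p.app U f + sectionOn t (p ⁻¹ᵁ U) *
          p.app U (show Γ(X.left, U) from appLE D (homOfLE le_top) (dSection X U f))) *
        (p.app U g + sectionOn t (p ⁻¹ᵁ U) *
          p.app U (show Γ(X.left, U) from appLE D (homOfLE le_top) (dSection X U g))) := by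
  rw [add_mul_add_eq_of_mul_self_eq_zero (sectionOn_mul_self t ht (p ⁻¹ᵁ U)), appLE_dSection_mul, map_mul, map_add,
    map_mul, map_mul]

/-- **Naturality**: the flow maps commute with restriction (`p♯`, `t|` and `D ∘ d` do).
[cite: Hartshorne1977, II Ex. 2.4 and II.8 (p. 175)] -/
theorem flowApp_map {U V : X.left.Opens} (i : V ⟶ U) (f : Γ(X.left, U)) :
    X'.presheaf.map ((Opens.map p.base).map i).op
        (p.app U f + sectionOn t (p ⁻¹ᵁ U) *
          p.app U (show Γ(X.left, U) from appLE D (homOfLE le_top) (dSection X U f))) =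
      p.app V (X.left.presheaf.map i.op f) + sectionOn t (p ⁻¹ᵁ V) *
        p.app V (show Γ(X.left, V) from appLE D (homOfLE le_top) (dSection X V (X.left.presheaf.map i.op f))) := by
  have hn : ∀ g : Γ(X.left, U), X'.presheaf.map ((Opens.map p.base).map i).op (p.app U g) =
      p.app V (X.left.presheaf.map i.op g) := fun g => by
    have nat := p.naturality i.op
    simp only [Quiver.Hom.unop_op] at nat
    rw [← CategoryTheory.comp_apply, ← nat, CategoryTheory.comp_apply]
  rw [map_add, map_mul, hn, hn, map_appLE_dSection]
  congr 2
  have : ((Opens.map p.base).map i) = homOfLE ((Opens.map p.base).map i).le := Subsingleton.elim _ _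
  rw [this, map_sectionOn]

end FlowApp

/-! ## §4 The first-order flow `Φ_D : X ⊗ Spec k[ε] ⟶ X` -/

section Flow

variable {k : Type u} [Field k] (X : Motives.SchemeOver k)
  (D : (cotangentSheaf X).over ⊤ ⟶ (unitModule X.left).over ⊤)

/-- **THE FIRST-ORDER FLOW of a global vector field** (letter (α) of the cell's `SOCKETS-I2a-seam.v0`): there is a morphism
`Φ : X ⊗ Spec k[ε] ⟶ X` over `Spec k` which (i) is the identity on the closed fibre, (ii) has the underlying continuous map
of the projection `p`, and (iii) acts on functions by the SECTION FORMULA `Φ♯ f = p♯ f + t · p♯(D(df))` (on every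
`V ≤ p⁻¹ U`, through `appLE`).  Construction: the locally-ringed-space morphism `(p, f ↦ p♯ f + t · p♯(D(df)))` (§3; local on
stalks because `t` is nilpotent, over `Spec k` because `d` kills `k`). [cite: MumfordAV1970, §13, proof of the Theorem (p. 125)]
[cite: Hartshorne2010, Ex. 5.2 (p. 45)] [cite: GortzWedhorn2023, Rem. 27.18 (4)] -/
theorem exists_firstOrderFlow :
    ∃ Φ : X ⊗ (ArtAlg.sqZeroExt (k := k) k).specOver ⟶ X,
      closedFibreι X (ArtAlg.sqZeroExt (k := k) k) ≫ Φ.left = 𝟙 X.left ∧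
      Φ.left.base = (fst X (ArtAlg.sqZeroExt (k := k) k).specOver).left.base ∧
      ∀ (U : X.left.Opens) (V : (X ⊗ (ArtAlg.sqZeroExt (k := k) k).specOver).left.Opens)
        (h₁ : V ≤ Φ.left ⁻¹ᵁ U) (h₂ : V ≤ (fst X (ArtAlg.sqZeroExt (k := k) k).specOver).left ⁻¹ᵁ U)
        (f : Γ(X.left, U)),
        Φ.left.appLE U V h₁ f =
          (fst X (ArtAlg.sqZeroExt (k := k) k).specOver).left.appLE U V h₂ f +
            sectionOn (deformationParam X) V *
              (fst X (ArtAlg.sqZeroExt (k := k) k).specOver).left.appLE U V h₂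
                (show Γ(X.left, U) from appLE D (homOfLE le_top) (dSection X U f)) := by
  -- the projection, the parameter
  let T : Motives.SchemeOver k := (ArtAlg.sqZeroExt (k := k) k).specOver
  let X' : Scheme.{u} := (X ⊗ T).left
  let p : X' ⟶ X.left := pullback.fst X.hom T.hom
  let t : Γ(X', ⊤) := deformationParam X
  have ht : t * t = 0 := deformationParam_mul_self X
  -- the sheaf map
  let c : X.left.presheaf ⟶ p.base _* X'.presheaf :=
    { app := fun U => CommRingCat.ofHom
        { toFun := fun f => p.app U.unop f + sectionOn t (p ⁻¹ᵁ U.unop) *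
            p.app U.unop (show Γ(X.left, U.unop) from appLE D (homOfLE le_top) (dSection X U.unop f))
          map_one' := flowApp_one D p t U.unop
          map_mul' := fun f g => flowApp_mul D p t ht U.unop f g
          map_zero' := flowApp_zero D p t U.unop
          map_add' := fun f g => flowApp_add D p t U.unop f g }
      naturality := fun U V i => by
        ext f
        exact (flowApp_map D p t i.unop f).symm }
  let φ : X'.toPresheafedSpace ⟶ X.left.toPresheafedSpace := { base := p.base, c := c }
  -- locality of the stalk maps: `φ_x = p_x + (nilpotent)`, and `p_x` is local
  have hloc : ∀ x : X', IsLocalHom (PresheafedSpace.Hom.stalkMap φ x).hom := by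
    intro x
    refine ⟨fun a ha => ?_⟩
    obtain ⟨U, hxU, f, rfl⟩ := X.left.presheaf.exists_germ_eq a
    rw [PresheafedSpace.stalkMap_germ_apply] at ha
    change IsUnit (X'.presheaf.germ (p ⁻¹ᵁ U) x hxU (p.app U f + sectionOn t (p ⁻¹ᵁ U) *
      p.app U (show Γ(X.left, U) from appLE D (homOfLE le_top) (dSection X U f)))) at ha
    rw [map_add, map_mul] at ha
    have hn : X'.presheaf.germ (p ⁻¹ᵁ U) x hxU (sectionOn t (p ⁻¹ᵁ U)) *
        X'.presheaf.germ (p ⁻¹ᵁ U) x hxU (sectionOn t (p ⁻¹ᵁ U)) = 0 := by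
      rw [← map_mul, sectionOn_mul_self t ht, map_zero]
    have hu := isUnit_of_isUnit_add_mul_of_mul_self_eq_zero hn ha
    rw [← Scheme.Hom.germ_stalkMap_apply p U x hxU f] at hu
    exact (isUnit_map_iff (p.stalkMap x).hom _).mp hu
  let Φ₀ : X' ⟶ X.left := ⟨⟨φ, hloc⟩⟩
  have hbase : Φ₀.base = p.base := rfl
  have happ : ∀ (U : X.left.Opens) (f : Γ(X.left, U)), Φ₀.app U f = p.app U f + sectionOn t (p ⁻¹ᵁ U) *
      p.app U (show Γ(X.left, U) from appLE D (homOfLE le_top) (dSection X U f)) := fun _ _ => rfl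
  -- `Φ₀` lies over `Spec k`: `d` kills the scalars
  have hover : Φ₀ ≫ X.hom = p ≫ X.hom := by
    refine ext_of_isAffine ?_
    rw [Scheme.Hom.comp_appTop, Scheme.Hom.comp_appTop]
    ext c₀
    change Φ₀.app ⊤ (X.hom.appTop c₀) = p.app ⊤ (X.hom.appTop c₀)
    rw [happ]
    have h0 : (show Γ(X.left, ⊤) from appLE D (homOfLE le_top) (dSection X ⊤ (X.hom.appTop c₀))) = 0 := by
      have h := appLE_dSection_map_appTop D ⊤ c₀
      have hid : (homOfLE (le_top : (⊤ : X.left.Opens) ≤ ⊤)) = 𝟙 _ := Subsingleton.elim _ _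
      rw [hid, op_id, X.left.presheaf.map_id] at h
      exact h
    rw [h0, map_zero, mul_zero, add_zero]
  -- `Φ₀` is the identity on the closed fibre
  have hιp : closedFibreι X (ArtAlg.sqZeroExt (k := k) k) ≫ p = 𝟙 X.left := closedFibreι_fst X _
  have hιt : (closedFibreι X (ArtAlg.sqZeroExt (k := k) k)).appTop t = 0 := closedFibreι_appTop_deformationParam X
  have hι : closedFibreι X (ArtAlg.sqZeroExt (k := k) k) ≫ Φ₀ = 𝟙 X.left := by
    refine Scheme.Hom.ext (by rw [Scheme.Hom.comp_base, hbase, ← Scheme.Hom.comp_base, hιp]) fun U => ?_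
    have hc := Scheme.Hom.congr_app hιp U
    rw [Scheme.Hom.comp_app] at hc
    rw [Scheme.Hom.comp_app]
    ext f
    change X.left.presheaf.map (eqToHom _).op ((closedFibreι X (ArtAlg.sqZeroExt (k := k) k)).app _ (Φ₀.app U f)) =
      (𝟙 X.left : X.left ⟶ X.left).app U f
    rw [happ, map_add, map_mul, app_sectionOn _ t hιt, zero_mul, add_zero]
    change X.left.presheaf.map (eqToHom _).op ((p.app U ≫ (closedFibreι X (ArtAlg.sqZeroExt (k := k) k)).app _) f) = _
    rw [hc, CategoryTheory.comp_apply, ← CategoryTheory.comp_apply (X.left.presheaf.map _), ← Functor.map_comp,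
      ← op_comp, eqToHom_trans, eqToHom_refl, op_id, X.left.presheaf.map_id, CategoryTheory.id_apply]
  -- assemble
  refine ⟨Over.homMk Φ₀ (by rw [hover]; rfl), hι, rfl, fun U V h₁ h₂ f => ?_⟩
  have hs : X'.presheaf.map (homOfLE h₂ : V ⟶ p ⁻¹ᵁ U).op (sectionOn t (p ⁻¹ᵁ U)) = sectionOn t V :=
    map_sectionOn t h₂
  change X'.presheaf.map (homOfLE h₂ : V ⟶ p ⁻¹ᵁ U).op (Φ₀.app U f) =
    X'.presheaf.map (homOfLE h₂ : V ⟶ p ⁻¹ᵁ U).op (p.app U f) +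
      sectionOn t V * X'.presheaf.map (homOfLE h₂ : V ⟶ p ⁻¹ᵁ U).op
        (p.app U (show Γ(X.left, U) from appLE D (homOfLE le_top) (dSection X U f)))
  rw [happ, map_add, map_mul, hs]

end Flow

end Literature.AlgebraicGeometry.Deformation

end
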